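import Literature.Analysis.FluidPDE.PineauVicolWeightBounds
import Literature.Analysis.FluidPDE.RadialCalculus

/-!
# Route `FilamentSkeletonRss` · negative item `NoExactProfileNearSymmetricPair` (stmt-NavierStokesRegularity-24091) — S_γ groundwork (B6):
# the EXPONENTIAL (Freidlin–Wentzell-type) BARRIER BOUND for subsolutions of drift–diffusion operators

Helper file (theorems only), `--supports stmt-NavierStokesRegularity-24091 --as helper`; LEAD of 23611 / registrar of 23920, lane ns-filament-21221-p1 g15.

WHY.  Step (γ-2)/(γ-3) of the B2′ design note (`Cruxes/TransverseReductionRJ/Lines/defect_column_gate_1AR_B2_gamma.md`) asks for UPPER bounds of Freidlin–Wentzell type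
(`|Ω| ≤ e^{−Γ(V+μ)}` off the escape sector) for the vorticity `Ω = curl U` of a hypothetical exact profile on the outer layer.  The kernel mechanism is a barrier:
for the operator `L = −Δ − b·∇ + V` (`V ≥ 0`; e.g. `q = |Ω|²` is an `L`-subsolution with `b = −v`, `V = 2 − 2λ_max(S)` wherever the strain is `< 1`, by the forward twin of
`inner_vorticityAdjoint_eq`), the function `B = e^{−ΓΦ}` is a SUPERSOLUTION as soon as `Φ ∈ C²` satisfies the (viscous) Hamilton–Jacobi inequality
`Γ‖∇Φ‖² ≤ ΔΦ + DΦ[b] + V/Γ` on `D` — at the window scale (`Φ(y) = φ(y/√Γ)`, `b = √Γ·b̂(y/√Γ)`) this is `‖∇φ‖² ≤ b̂·∇φ + O(1/Γ)`, the quasi-potential inequality along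
the drift — and then every subsolution below `M·e^{−ΓΦ}` on `∂D` stays below it on `D̄` (weak maximum principle, tree `PineauVicol2026.weak_maximum_principle`).
So exponential smallness PROPAGATES from the boundary into the domain at the rate `e^{−ΓΦ}`: the log-precision upper-bound half of (γ-2), reduced to (i) boundary values
(interior regularity on the tube walls — NOT here) and (ii) the choice of `Φ` (geometry of the frozen drift — NOT here).

* `laplacian_exp_neg_mul` — `Δ(e^{−ΓΦ}) = (Γ²‖∇Φ‖² − ΓΔΦ)·e^{−ΓΦ}`;
* `exp_barrier_supersolution` — under `Γ‖∇Φ‖² ≤ ΔΦ + DΦ[b] + V/Γ` (`Γ > 0`): `−ΔB − DB[b] + V·B ≥ 0` for `B = e^{−ΓΦ}`;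
* `exp_barrier_bound` — `D` bounded open, `b`, `V` bounded, `V ≥ 0`; `q ∈ C²` with `−Δq − Dq[b] + Vq ≤ 0` on `D` and `q ≤ M·e^{−ΓΦ}` on `∂D` (`M ≥ 0`) ⇒ `q ≤ M·e^{−ΓΦ}` on `D̄`;
* (appended) `gaussian_upstream_decay` — the `Γ = 1` instance for the free drift `b = −½x + s`, `s` skew: `Φ = (R² − ‖x‖²)/4`, `V ≥ n/2` ⇒ Gaussian decay into the ball.
HONEST FRAMING: an abstract elliptic lemma filed as groundwork on the NEGATIVE side of a HYPOTHETICAL filament-type rotating-self-similar blow-up route (MODEL rung);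
24091/23611/23920 OPEN; nothing here bears on Navier–Stokes regularity, which is NOT proved.
-/

set_option linter.dupNamespace false

noncomputable section

namespace Summit.NavierStokesRegularity.NavierStokesRegularity.Theorems.DefectColumnGate

open scoped Topology InnerProductSpace Laplacian ContDiff
open Set Function Metric
open Literature.Analysis.FluidPDE

variable {E : Type} [NormedAddCommGroup E] [InnerProductSpace ℝ E] [FiniteDimensional ℝ E]

omit [FiniteDimensional ℝ E] in
/-- `D(e^{−ΓΦ})(x)[h] = −Γ·e^{−ΓΦ(x)}·DΦ(x)[h]`. -/
theorem fderiv_exp_neg_mul {Φ : E → ℝ} (hΦ : ContDiff ℝ 2 Φ) (Γ : ℝ) (x h : E) :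
    fderiv ℝ (fun y => Real.exp (-Γ * Φ y)) x h = -Γ * Real.exp (-Γ * Φ x) * fderiv ℝ Φ x h := by
  have hΦd : DifferentiableAt ℝ Φ x := hΦ.differentiable (by norm_num) x
  have h1 : HasFDerivAt (fun y => -Γ * Φ y) ((-Γ) • fderiv ℝ Φ x) x := hΦd.hasFDerivAt.const_mul (-Γ)
  rw [(h1.exp).fderiv]
  simp only [FunLike.coe_smul, Pi.smul_apply, smul_eq_mul]
  ring

/-- **Laplacian of an exponential barrier**: `Δ(e^{−ΓΦ})(x) = (Γ²‖∇Φ(x)‖² − Γ·ΔΦ(x))·e^{−ΓΦ(x)}` for `Φ ∈ C²`. -/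
theorem laplacian_exp_neg_mul {Φ : E → ℝ} (hΦ : ContDiff ℝ 2 Φ) (Γ : ℝ) (x : E) :
    (Δ (fun y => Real.exp (-Γ * Φ y))) x = (Γ ^ 2 * ‖gradient Φ x‖ ^ 2 - Γ * (Δ Φ) x) * Real.exp (-Γ * Φ x) := by
  have hψ : ContDiff ℝ 2 (fun s : ℝ => Real.exp (-Γ * s)) := (contDiff_const.mul contDiff_id).exp
  have hd1 : deriv (fun s : ℝ => Real.exp (-Γ * s)) = fun s => -Γ * Real.exp (-Γ * s) := by
    funext s
    have h : HasDerivAt (fun s : ℝ => Real.exp (-Γ * s)) (Real.exp (-Γ * s) * (-Γ * 1)) s := ((hasDerivAt_id s).const_mul (-Γ)).exp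
    rw [h.deriv]; ring
  have hd2 : deriv (deriv (fun s : ℝ => Real.exp (-Γ * s))) = fun s => Γ ^ 2 * Real.exp (-Γ * s) := by
    rw [hd1]; funext s
    have h : HasDerivAt (fun s : ℝ => -Γ * Real.exp (-Γ * s)) (-Γ * (Real.exp (-Γ * s) * (-Γ * 1))) s :=
      (((hasDerivAt_id s).const_mul (-Γ)).exp).const_mul (-Γ)
    rw [h.deriv]; ring
  have hcomp : (fun y => Real.exp (-Γ * Φ y)) = (fun s : ℝ => Real.exp (-Γ * s)) ∘ Φ := rfl
  rw [hcomp, PineauVicol2026.laplacian_comp_eq hψ hΦ x, hd2, hd1]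
  ring

/-- **The exponential barrier is a supersolution under the Hamilton–Jacobi inequality.**  Let `Γ > 0`, `Φ ∈ C²`, and suppose at `x`:
`Γ·‖∇Φ(x)‖² ≤ ΔΦ(x) + DΦ(x)[b(x)] + V(x)/Γ`.  Then `B = e^{−ΓΦ}` satisfies `−ΔB(x) − DB(x)[b(x)] + V(x)·B(x) ≥ 0`. -/
theorem exp_barrier_supersolution {Φ : E → ℝ} (hΦ : ContDiff ℝ 2 Φ) {Γ : ℝ} (hΓ : 0 < Γ) (b : E → E) (V : E → ℝ) {x : E}
    (hHJ : Γ * ‖gradient Φ x‖ ^ 2 ≤ (Δ Φ) x + fderiv ℝ Φ x (b x) + V x / Γ) :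
    0 ≤ -(Δ (fun y => Real.exp (-Γ * Φ y))) x - fderiv ℝ (fun y => Real.exp (-Γ * Φ y)) x (b x) + V x * Real.exp (-Γ * Φ x) := by
  rw [laplacian_exp_neg_mul hΦ Γ x, fderiv_exp_neg_mul hΦ Γ x]
  have hB : 0 < Real.exp (-Γ * Φ x) := Real.exp_pos _
  have hkey : 0 ≤ -(Γ ^ 2 * ‖gradient Φ x‖ ^ 2 - Γ * (Δ Φ) x) + Γ * fderiv ℝ Φ x (b x) + V x := by
    have h1 : Γ * (Γ * ‖gradient Φ x‖ ^ 2) ≤ Γ * ((Δ Φ) x + fderiv ℝ Φ x (b x) + V x / Γ) := mul_le_mul_of_nonneg_left hHJ hΓ.le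
    have h2 : Γ * (V x / Γ) = V x := by field_simp
    nlinarith
  have := mul_nonneg hkey hB.le
  nlinarith

/-- **EXPONENTIAL BARRIER BOUND (Freidlin–Wentzell upper-bound mechanism).**  Let `D ⊆ E` be bounded and open, `b` and `V` bounded on `D` with `V ≥ 0`, `Γ > 0`, and
`Φ ∈ C²` with the Hamilton–Jacobi inequality `Γ‖∇Φ‖² ≤ ΔΦ + DΦ[b] + V/Γ` on `D`.  If `q ∈ C²` is a subsolution, `−Δq − Dq[b] + V·q ≤ 0` on `D`, and `q ≤ M·e^{−ΓΦ}` on `∂D`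
for some `M ≥ 0`, then `q ≤ M·e^{−ΓΦ}` on `D̄`.  (`e` is any unit vector, consumed by the weak maximum principle's own barrier.) -/
theorem exp_barrier_bound {D : Set E} (hD : IsOpen D) (hDb : Bornology.IsBounded D) {e : E} (he : ‖e‖ = 1)
    {Φ q : E → ℝ} (hΦ : ContDiff ℝ 2 Φ) (hq : ContDiff ℝ 2 q) {Γ : ℝ} (hΓ : 0 < Γ)
    {b : E → E} {V : E → ℝ} {B₀ V₀ : ℝ} (hB₀ : 0 ≤ B₀) (hV₀0 : 0 ≤ V₀)
    (hb : ∀ x ∈ D, ‖b x‖ ≤ B₀) (hV : ∀ x ∈ D, 0 ≤ V x) (hV₀ : ∀ x ∈ D, V x ≤ V₀)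
    (hHJ : ∀ x ∈ D, Γ * ‖gradient Φ x‖ ^ 2 ≤ (Δ Φ) x + fderiv ℝ Φ x (b x) + V x / Γ)
    (hsub : ∀ x ∈ D, -(Δ q) x - fderiv ℝ q x (b x) + V x * q x ≤ 0)
    {M : ℝ} (hM : 0 ≤ M) (hbdry : ∀ x ∈ frontier D, q x ≤ M * Real.exp (-Γ * Φ x)) :
    ∀ x ∈ closure D, q x ≤ M * Real.exp (-Γ * Φ x) := by
  -- `φ = q − M e^{−ΓΦ}` is a subsolution, `≤ 0` on `∂D`
  have hB : ContDiff ℝ 2 (fun y => Real.exp (-Γ * Φ y)) := (contDiff_const.mul hΦ).exp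
  have hφ : ContDiff ℝ 2 (fun y => q y - M * Real.exp (-Γ * Φ y)) := hq.sub (contDiff_const.mul hB)
  have hsub' : ∀ x ∈ D, -(Δ (fun y => q y - M * Real.exp (-Γ * Φ y))) x - fderiv ℝ (fun y => q y - M * Real.exp (-Γ * Φ y)) x (b x)
      + V x * (q x - M * Real.exp (-Γ * Φ x)) ≤ 0 := by
    intro x hx
    have hMB : ContDiff ℝ 2 (fun y => M * Real.exp (-Γ * Φ y)) := contDiff_const.mul hB
    have hL : (Δ (fun y => q y - M * Real.exp (-Γ * Φ y))) x = (Δ q) x - M * (Δ (fun y => Real.exp (-Γ * Φ y))) x := by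
      have e1 : (fun y => q y - M * Real.exp (-Γ * Φ y)) = q - M • (fun y => Real.exp (-Γ * Φ y)) := by
        funext y; simp [smul_eq_mul]
      have hMB' : ContDiffAt ℝ 2 (M • fun y => Real.exp (-Γ * Φ y)) x := by
        have : (M • fun y => Real.exp (-Γ * Φ y)) = fun y => M * Real.exp (-Γ * Φ y) := by funext y; simp [smul_eq_mul]
        rw [this]; exact hMB.contDiffAt
      rw [e1, (hq.contDiffAt (x := x)).laplacian_sub hMB', InnerProductSpace.laplacian_smul M (hB.contDiffAt (x := x)), smul_eq_mul]
    have hDf : fderiv ℝ (fun y => q y - M * Real.exp (-Γ * Φ y)) x (b x) = fderiv ℝ q x (b x) - M * fderiv ℝ (fun y => Real.exp (-Γ * Φ y)) x (b x) := by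
      rw [fderiv_fun_sub (hq.differentiable (by norm_num) x) (hMB.differentiable (by norm_num) x),
        fderiv_const_mul (hB.differentiable (by norm_num) x)]
      simp only [FunLike.coe_sub, Pi.sub_apply, FunLike.coe_smul, Pi.smul_apply, smul_eq_mul]
    rw [hL, hDf]
    have h1 := hsub x hx
    have h2 := exp_barrier_supersolution hΦ hΓ b V (hHJ x hx)
    have h3 := mul_nonneg hM h2
    nlinarith
  have hbdry' : ∀ x ∈ frontier D, q x - M * Real.exp (-Γ * Φ x) ≤ 0 := fun x hx => by linarith [hbdry x hx]
  have hmax := PineauVicol2026.weak_maximum_principle hD hDb he hφ hB₀ hV₀0 hb hV hV₀ hsub' le_rfl hbdry'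
  intro x hx
  linarith [hmax x hx]

/-! ## Appended (LEAD g15, same day): the GAUSSIAN instance — upstream decay for the free backward-Leray drift (sanity check of the mechanism, Γ = 1) -/

/-- The quadratic quasi-potential `Φ(x) = (R² − ‖x‖²)/4`: gradient `−½x`, Laplacian `−n/2`. -/
theorem gradient_quadPotential (R : ℝ) (x : E) :
    gradient (fun y : E => ((R ^ 2 - ‖y‖ ^ 2) / 4 : ℝ)) x = (-(1/2:ℝ)) • x := by
  have hg : HasDerivAt (fun u : ℝ => (R ^ 2 - u) / 4) (-(1/4:ℝ)) (‖x‖ ^ 2) := by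
    have := ((hasDerivAt_id (‖x‖ ^ 2)).const_sub (R ^ 2)).div_const 4
    exact this.congr_deriv (by ring)
  have hD := (hasFDerivAt_comp_norm_sq (E := E) hg).fderiv
  rw [gradient, hD, map_smul]
  have h1 : (InnerProductSpace.toDual ℝ E).symm (innerSL ℝ x : E →L[ℝ] ℝ) = x := by
    apply (InnerProductSpace.toDual ℝ E).injective
    rw [LinearIsometryEquiv.apply_symm_apply]
    ext y
    simp [InnerProductSpace.toDual_apply_apply]
  rw [h1]
  norm_num

omit [FiniteDimensional ℝ E] in
/-- `DΦ(x)[h] = −½⟪x, h⟫` for `Φ(x) = (R² − ‖x‖²)/4`. -/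
theorem fderiv_quadPotential (R : ℝ) (x h : E) :
    fderiv ℝ (fun y : E => ((R ^ 2 - ‖y‖ ^ 2) / 4 : ℝ)) x h = -(1/2:ℝ) * ⟪x, h⟫_ℝ := by
  have hg : HasDerivAt (fun u : ℝ => (R ^ 2 - u) / 4) (-(1/4:ℝ)) (‖x‖ ^ 2) := by
    have := ((hasDerivAt_id (‖x‖ ^ 2)).const_sub (R ^ 2)).div_const 4
    exact this.congr_deriv (by ring)
  rw [fderiv_comp_norm_sq_apply (E := E) hg]
  ring

/-- `ΔΦ = −n/2` for `Φ(x) = (R² − ‖x‖²)/4`, `n = dim E`. -/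
theorem laplacian_quadPotential (R : ℝ) (x : E) :
    (Δ (fun y : E => ((R ^ 2 - ‖y‖ ^ 2) / 4 : ℝ))) x = -((Module.finrank ℝ E : ℝ) / 2) := by
  have hg : ∀ σ ∈ (Set.univ : Set ℝ), HasDerivAt (fun u : ℝ => (R ^ 2 - u) / 4) ((fun _ : ℝ => -(1/4:ℝ)) σ) σ := fun σ _ => by
    have := ((hasDerivAt_id σ).const_sub (R ^ 2)).div_const 4
    exact this.congr_deriv (by norm_num)
  rw [laplacian_comp_norm_sq (E := E) (g := fun u : ℝ => (R ^ 2 - u) / 4) isOpen_univ hg (Set.mem_univ _) (hasDerivAt_const _ _)]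
  ring

/-- **GAUSSIAN UPSTREAM DECAY for the free backward-Leray drift (the `Γ = 1` instance of `exp_barrier_bound`).**  Let `D ⊆ E` be bounded open, `n = dim E`, and let the drift be
`b(x) = −½x + s(x)` with `s` bounded on `D` and SKEW in the sense `⟪x, s(x)⟫ = 0` (e.g. `s(x) = α e₃×x` on `ℝ³`: the frame field of the profile equation with `U = 0`, reversed).
If `V ≥ n/2` on `D` (bounded above), `q ∈ C²` satisfies `−Δq − Dq[b] + Vq ≤ 0` on `D` and `q ≤ M e^{−(R²−‖x‖²)/4}` on `∂D` (`M ≥ 0`), then `q(x) ≤ M e^{−(R²−‖x‖²)/4}` on `D̄`: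
subsolutions decay like the Gaussian INTO the ball from data on `‖x‖ = R` — the Freidlin–Wentzell rate of the outward Ornstein–Uhlenbeck drift `½x`, quasi-potential `‖x‖²/4`
(at the window scale `R ~ √Γ` this is `e^{−Γ(R̂² − ‖x̂‖²)/4}`). -/
theorem gaussian_upstream_decay {D : Set E} (hD : IsOpen D) (hDb : Bornology.IsBounded D) {e : E} (he : ‖e‖ = 1)
    {q : E → ℝ} (hq : ContDiff ℝ 2 q) {s : E → E} {S₀ V₀ : ℝ} (hS₀ : 0 ≤ S₀) (hs : ∀ x ∈ D, ‖s x‖ ≤ S₀) (hskew : ∀ x ∈ D, ⟪x, s x⟫_ℝ = 0)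
    {V : E → ℝ} (hV : ∀ x ∈ D, (Module.finrank ℝ E : ℝ) / 2 ≤ V x) (hV₀ : ∀ x ∈ D, V x ≤ V₀)
    (hsub : ∀ x ∈ D, -(Δ q) x - fderiv ℝ q x (-(1/2:ℝ) • x + s x) + V x * q x ≤ 0)
    (R : ℝ) {M : ℝ} (hM : 0 ≤ M) (hbdry : ∀ x ∈ frontier D, q x ≤ M * Real.exp (-1 * ((R ^ 2 - ‖x‖ ^ 2) / 4))) :
    ∀ x ∈ closure D, q x ≤ M * Real.exp (-1 * ((R ^ 2 - ‖x‖ ^ 2) / 4)) := by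
  rcases D.eq_empty_or_nonempty with hDe | ⟨x₀, hx₀⟩
  · intro x hx; rw [hDe, closure_empty] at hx; exact absurd hx (Set.notMem_empty x)
  have hn0 : (0:ℝ) ≤ (Module.finrank ℝ E : ℝ) / 2 := by positivity
  have hV₀0 : 0 ≤ V₀ := hn0.trans ((hV x₀ hx₀).trans (hV₀ x₀ hx₀))
  -- the drift is bounded on the bounded set `D`
  obtain ⟨ρ, hρ⟩ := hDb.subset_closedBall (0 : E)
  have hb : ∀ x ∈ D, ‖-(1/2:ℝ) • x + s x‖ ≤ (1/2:ℝ) * max ρ 0 + S₀ := by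
    intro x hx
    have hx' : ‖x‖ ≤ max ρ 0 := le_trans (by simpa using hρ hx) (le_max_left _ _)
    calc ‖-(1/2:ℝ) • x + s x‖ ≤ ‖-(1/2:ℝ) • x‖ + ‖s x‖ := norm_add_le _ _
      _ ≤ (1/2:ℝ) * max ρ 0 + S₀ := by
          rw [norm_smul, norm_neg, Real.norm_eq_abs, abs_of_pos (by norm_num : (0:ℝ) < 1/2)]
          exact add_le_add (mul_le_mul_of_nonneg_left hx' (by norm_num)) (hs x hx)
  have hΦ : ContDiff ℝ 2 (fun y : E => ((R ^ 2 - ‖y‖ ^ 2) / 4 : ℝ)) := (contDiff_const.sub (contDiff_norm_sq ℝ)).div_const 4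
  -- the Hamilton–Jacobi inequality with `Γ = 1`: `‖x‖²/4 ≤ −n/2 + ‖x‖²/4 + V`
  have hHJ : ∀ x ∈ D, (1:ℝ) * ‖gradient (fun y : E => ((R ^ 2 - ‖y‖ ^ 2) / 4 : ℝ)) x‖ ^ 2
      ≤ (Δ (fun y : E => ((R ^ 2 - ‖y‖ ^ 2) / 4 : ℝ))) x + fderiv ℝ (fun y : E => ((R ^ 2 - ‖y‖ ^ 2) / 4 : ℝ)) x (-(1/2:ℝ) • x + s x) + V x / 1 := by
    intro x hx
    rw [gradient_quadPotential, laplacian_quadPotential, fderiv_quadPotential, inner_add_right, inner_smul_right, hskew x hx, real_inner_self_eq_norm_sq,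
      norm_smul, norm_neg, Real.norm_eq_abs, abs_of_pos (by norm_num : (0:ℝ) < 1/2)]
    have := hV x hx
    nlinarith [sq_nonneg ‖x‖]
  exact exp_barrier_bound hD hDb he hΦ hq one_pos (by positivity) hV₀0 hb (fun x hx => hn0.trans (hV x hx)) hV₀ hHJ hsub hM hbdry

end Summit.NavierStokesRegularity.NavierStokesRegularity.Theorems.DefectColumnGate

end
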